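import Summits.RiemannHypothesis.RiemannHypothesis.Theorems.DBNSimpleRealZerosPersist
import Summits.RiemannHypothesis.RiemannHypothesis.Theorems.DBNUniformFarZerosReal
import Literature.NumberTheory.LFunctions.EquivalentsHolds
import HarnessLib

/-!
# RiemannHypothesis / DBN — RH-FREE leaf K2: coalescence at a positive de Bruijn–Newman constant

LINE 1 — LABEL: `coalescenceAtLambda` is **RH-FREE** (hypothesis `0 < Λ` = ¬RH; content:
continuity + compactness + the uniform Ki–Kim–Lee box; proved without deciding RH);
`riemannHypothesis_iff_forall_pos_simple` is a kernel EQUIVALENCE certifying that the isolated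
statement of column DBN — no coalescence of real zeros of `H_t` at any positive time,
`DbnTheory.NoCoalescence` of `Theorems/DBNNoCoalescence.lean` — is **RH-EQUIVALENT** (both
directions, unconditional, standard axioms).  bears_on: N-C/N-P (LADDER-RH §1, COLUMN 3 DBN; C3
corpus `rh-crit/rt`, RESIDUAL.md §3 K2 + DOOR).  WHAT THIS IS NOT: not progress toward RH — it fixes
WHICH degenerate configuration (a double real zero of `H_Λ` at a positive time `Λ`) ¬RH forces, it
does not exclude it; nothing here bears on the truth of RH.

Objects: `H_t = Literature.NumberTheory.LFunctions.deBruijnH t`,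
`Λ = Literature.NumberTheory.LFunctions.deBruijnNewmanConst` (`0 ≤ Λ ≤ 1/2`, Rodgers–Tao / de Bruijn,
`deBruijnNewmanConst_mem_Icc`; RH ↔ `Λ ≤ 0`, `riemannHypothesis_iff_deBruijnNewmanConst_nonpos`).

* `coalescenceAtLambda` — `0 < Λ → ∃ x : ℝ, H_Λ(x) = 0 ∧ H_Λ'(x) = 0`.  `H_Λ` is real-rooted
  (`hasOnlyRealZeros_deBruijnH_deBruijnNewmanConst`, Newman closedness).  If all its real zeros were
  simple: K1 (`exists_uniform_far_zeros_real`, sibling file `DBNUniformFarZerosReal`) gives one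
  `X` with all zeros of `H_t`, `t ≥ Λ/2`, `|Re z| ≥ X` real; K2a (`exists_delta_im_eq_zero_of_pos`,
  sibling file `DBNSimpleRealZerosPersist`) gives `δ ∈ (0, Λ]` with all zeros of `H_t`,
  `|t − Λ| < δ`, `|Re z| ≤ X` real; at `t = Λ − δ/2` every zero of `H_t` is real, so `Λ ≤ t`
  (`hasOnlyRealZeros_deBruijnH_iff_deBruijnNewmanConst_le_holds`) — absurd.
* `deBruijnNewmanConst_nonpos_of_simple_at_const` — contrapositive: all real zeros of `H_Λ` simple
  ⟹ `Λ ≤ 0`.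
* `riemannHypothesis_of_forall_pos_simple`, `riemannHypothesis_iff_forall_pos_simple` — THE DOOR in
  hypothesis-free form: (∀ t > 0, every real zero of `H_t` is simple) ↔ RH; ⟸ is
  Csordas–Smith–Varga 1994 Thm. 2.2 (`csordasSmithVarga_simple_zeros_holds`) with RH ↔ `Λ ≤ 0`
  (`deBruijnNewmanConst_le_iff_holds` at `0`).  The `Prop`-packaged forms
  (`DbnTheory.CoalescenceAtLambda_holds`, `noCoalescence_iff_riemannHypothesis` without hypothesis)
  follow in one line each once `Theorems/DBNNoCoalescence.lean` is in the tree (glue file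
  `DBNNoCoalescenceDoor`).

`--supports stmt-RiemannHypothesis-0274` (route DBN target X, which is itself ↔ RH:
`Theorems.dbnThesis_iff_summit`); closes nothing.  Theorems only.

References: G. Csordas, W. Smith, R. S. Varga, Constr. Approx. 10 (1994) 107–129, Thm. 2.2;
H. Ki, Y.-O. Kim, J. Lee, Adv. Math. 222 (2009), Thm. 1.3; C. M. Newman, Proc. AMS 61 (1976) Thm. 3;
B. Rodgers, T. Tao, Forum Math. Pi 8 (2020) e6, Thm. 1.1 and §4 (zero dynamics, p.13).
-/

noncomputable section

-- D-0017: `Summit.<S>.<S>.…` is the designed namespace of a single-problem summit.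
set_option linter.dupNamespace false

namespace Summit.RiemannHypothesis.RiemannHypothesis.Theorems.DbnTheory

open Literature.NumberTheory.LFunctions

/-! ## K2: coalescence at a positive de Bruijn–Newman constant -/

/-- **K2 (RH-FREE leaf) — coalescence at a positive de Bruijn–Newman constant.**  If `0 < Λ`, then
`H_Λ` has a multiple real zero: some real `x` with `H_Λ(x) = 0` and `H_Λ'(x) = 0`.  Proof: `H_Λ` is
real-rooted (Newman's closedness, `hasOnlyRealZeros_deBruijnH_deBruijnNewmanConst`); if all its
real zeros were simple, then for `t` slightly below `Λ` every zero of `H_t` would be real — the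
far ones (`|Re z| ≥ X`) by the uniform Ki–Kim–Lee threshold on `t ≥ Λ/2` (K1,
`exists_uniform_far_zeros_real`), the boxed ones by persistence of simple real zeros (K2a,
`exists_delta_im_eq_zero_of_pos`) — so `Λ ≤ t < Λ`
(`hasOnlyRealZeros_deBruijnH_iff_deBruijnNewmanConst_le_holds`), absurd.  The hypothesis `0 < Λ` is
`¬RH`; the statement is proved without deciding RH.  This is `DbnTheory.CoalescenceAtLambda`
(`Theorems/DBNNoCoalescence.lean`) unfolded. [folklore] -/
theorem coalescenceAtLambda (hpos : 0 < deBruijnNewmanConst) :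
    ∃ x : ℝ, deBruijnH deBruijnNewmanConst x = 0 ∧
      deriv (deBruijnH deBruijnNewmanConst) x = 0 := by
  by_contra hno
  push Not at hno
  have hreal : HasOnlyRealZeros (deBruijnH deBruijnNewmanConst) :=
    hasOnlyRealZeros_deBruijnH_deBruijnNewmanConst
  -- K1: one threshold for all `t ≥ Λ/2`
  obtain ⟨X, hX⟩ := exists_uniform_far_zeros_real (half_pos hpos)
  -- K2a at `t₀ = Λ` on the box `|Re z| ≤ X`
  obtain ⟨δ, hδ, hδΛ, hbox⟩ := exists_delta_im_eq_zero_of_pos hpos X hreal hno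
  -- a time slightly below `Λ`
  set t : ℝ := deBruijnNewmanConst - δ / 2 with ht
  have ht1 : deBruijnNewmanConst / 2 ≤ t := by rw [ht]; linarith
  have ht2 : |t - deBruijnNewmanConst| < δ := by
    rw [ht, show deBruijnNewmanConst - δ / 2 - deBruijnNewmanConst = -(δ / 2) by ring, abs_neg,
      abs_of_pos (by positivity)]
    linarith
  have hreal_t : HasOnlyRealZeros (deBruijnH t) := by
    intro z hz
    rcases le_or_gt X |z.re| with hge | hlt
    · exact hX t ht1 z hz hge
    · exact hbox t ht2 z hz hlt.le
  have hle : deBruijnNewmanConst ≤ t :=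
    (hasOnlyRealZeros_deBruijnH_iff_deBruijnNewmanConst_le_holds t).1 hreal_t
  rw [ht] at hle
  linarith

/-- Contrapositive packaging: if every real zero of `H_Λ` is simple then `Λ ≤ 0` (with Rodgers–Tao
`Λ ≥ 0`, `deBruijnNewmanConst_nonneg_holds`: `Λ = 0`). [folklore] -/
theorem deBruijnNewmanConst_nonpos_of_simple_at_const
    (h : ∀ x : ℝ, deBruijnH deBruijnNewmanConst x = 0 → deriv (deBruijnH deBruijnNewmanConst) x ≠ 0) :
    deBruijnNewmanConst ≤ 0 := by
  by_contra hpos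
  push Not at hpos
  obtain ⟨x, hx, hdx⟩ := coalescenceAtLambda hpos
  exact h x hx hdx

/-- **The door, hypothesis-free form** (no reference to the `Prop` packages): if for every `t > 0`
every real zero of `H_t` is simple, then the Riemann Hypothesis holds.  (`Λ ≤ 0` by
`deBruijnNewmanConst_nonpos_of_simple_at_const` — at `t = Λ` if `Λ > 0` — then
`riemannHypothesis_iff_deBruijnNewmanConst_nonpos`.)  RH-FREE theorem about an RH-EQUIVALENT
hypothesis; nothing here bears on the truth of RH. [folklore] -/
theorem riemannHypothesis_of_forall_pos_simple
    (h : ∀ t : ℝ, 0 < t → ∀ x : ℝ, deBruijnH t x = 0 → deriv (deBruijnH t) x ≠ 0) :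
    RiemannHypothesis := by
  refine riemannHypothesis_iff_deBruijnNewmanConst_nonpos.2 ?_
  by_contra hpos
  push Not at hpos
  obtain ⟨x, hx, hdx⟩ := coalescenceAtLambda hpos
  exact h _ hpos x hx hdx

/-- Conversely (unconditional, Csordas–Smith–Varga + RH ↔ `Λ ≤ 0`): under RH every real zero of
every `H_t`, `t > 0`, is simple.  Hence the hypothesis-free equivalence. [folklore] -/
theorem riemannHypothesis_iff_forall_pos_simple :
    RiemannHypothesis ↔
      ∀ t : ℝ, 0 < t → ∀ x : ℝ, deBruijnH t x = 0 → deriv (deBruijnH t) x ≠ 0 := by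
  refine ⟨fun hRH t ht x hx ↦ ?_, riemannHypothesis_of_forall_pos_simple⟩
  have hΛ : deBruijnNewmanConst ≤ 0 := riemannHypothesis_iff_deBruijnNewmanConst_nonpos.1 hRH
  have hreal : HasOnlyRealZeros (deBruijnH (t / 2)) :=
    (deBruijnNewmanConst_le_iff_holds 0).1 hΛ (t / 2) (by positivity)
  exact csordasSmithVarga_simple_zeros_holds (t / 2) t (by linarith) hreal x hx

end Summit.RiemannHypothesis.RiemannHypothesis.Theorems.DbnTheory

end
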